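import Summits.BirchSwinnertonDyer.BirchSwinnertonDyer.Theorems.ByReductionTypeAtTwoSupersingularConjATwoGoodSSRowStampsA
import HarnessLib

/-!
# Route `ByReductionTypeAtTwo` (rung K4), crux `SupersingularRankZeroAtTwo` (item stmt-BirchSwinnertonDyer-19097), v2.12 (α) `FineMuZeroOnHabitatAtTwo`:
# GOOD-SUPERSINGULAR ROW STAMPS, part C — `Rank1Residual.FineMuZeroAt (M ⊗ ℚ) 2` / Coates–Sujatha (A)₂ for habitat rows `175c1` … `203a1` (rows 21–30 of the habitat by conductor) by conductor
# (Cremona minimal models `M`), each modulo print `hLim2` and — unless the kernel decides it — ONE displayed parity bit «`2 ∤ h(L_W)`»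
# (a `--supports 19097` file; seat `bsd-2adic-t42` GEN 43, hand h12 «D84 ROW-CERTIFICATE TYPING», director (810)(B) HAND 1; door `…GoodSSDoor`)

HONEST LABEL (cell `bsd-2adic`, D-0036/D-0054): «row certificates mod print (Lim 2017 Thm 3.5); (α) is class-wide and NOT discharged; CDC_H closed
MOD PRINT hPT; BSD proved for no curve». Per-row stamps only: they are BC5-type witnesses / honesty data for the registry's (α) binder
`∀ W [IsElliptic] [IsGloballyMinimal], ¬CM → r_an = 0 → GoodSS W 2 → Rank1Residual.FineMuZeroAt W 2` and do not discharge its `∀`; nothing booked.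
`IsGloballyMinimal` / `GoodSS` / `r_an = 0` / non-CM of the rows are NOT claimed here; for the rows that are UNIT ANCHORS of seat ss-1x (`…SupersingularUnitAnchorsA/C/D`)
the tree's `SSUnitAnchor.isElliptic_ua…` instance is REUSED (dedup) and `isGloballyMinimal_ua…` / `goodSS_two_ua…` decide the first two on the same `M ⊗ ℚ`.

THE HABITAT (crux 19097): non-CM, `r_an = 0`, good SUPERSINGULAR at `2` (`N` odd, `a₂(E) ∈ {0, ±2}`). Census of this hand (kit j343820, one batched PARI job
over Cremona `allcurves.00000-09999`): the 104 habitat isogeny classes with `N ≤ 600` (curve `1` of each class) all have `a₁ = 0, a₃ = 1`; their `2`-division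
cubic fields `L_W = ℚ(x(P))` (`2 = 𝔮³` always, Eisenstein) have ODD class number in 103/104 cases (`h ∈ {1, 3}`; the exception `571a1`: `d = −2284`, `h = 2`,
a layer-≥ 1 row of census2 j305417 — recorded in the cell memo `t42/D84-ROWS-GEN43.md`, not stamped). MECHANISM: `…GoodSSDoor` (the `2`-torsion point
`(β/4, −1/2)`, `β = 4x(P)` a root of `X³ + 4a₂X² + 16a₄X + (64a₆ + 16)`; `π = β/2` root of the Eisenstein cubic `Y³ + 2a₂Y² + 4a₄Y + (8a₆ + 2)`).

THIS PART (C): 10 rows — KERNEL bit (modulo `hLim2` ALONE, generator swap to a class-number-one field decided by the kernel: `d ∈ {−44, −76, −108, −780}`): `187a1`, `195b1`, `195c1`, `195d1`; DISPLAYED bit (`2 ∤ #Cl(𝓞 ℚ(β))`, census value in the docstring): `175c1`, `179a1`, `187b1`, `189c1`, `189d1`, `203a1`. The kernel class-number lemmas are §0 of part A.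

References: [Lim2017FineSelmer] Thm. 3.5, Lemma 3.2; [CoatesSujatha2005] (A); [Greenberg2001IwasawaPastPresent] Prop. 2.1 p. 339; [Cohen1993] App. B
Table B.4; [Marcus1977] Ch. 5; [CremonaAlgorithms1997] Table 1 (`allcurves`/`allbsd`); kit j343820 (`t42/gen43/h12rows.gp`, PARI 2.15: polredabs, bnfinit, bnfcertify).
-/

set_option autoImplicit false
-- sibling precedent (`…GoodSSDoor.lean`): the directory name repeats the summit name
set_option linter.dupNamespace false

noncomputable section

open scoped Classical IntermediateField NumberField

namespace Summit.BirchSwinnertonDyer.BirchSwinnertonDyer.Theorems.AddKatoTwo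

open WeierstrassCurve Field Polynomial IsDedekindDomain Literature.NumberTheory.EllipticCurves
  Literature.NumberTheory.GaloisRepresentations Literature.NumberTheory.IwasawaTheory
  Summit.BirchSwinnertonDyer.BirchSwinnertonDyer.Theorems.AlignedTransportAtTwoTorsionPointField
  Summit.BirchSwinnertonDyer.BirchSwinnertonDyer.Theses.ByReductionTypeAtTwo

/-! ## Rows 21–30 -/

/-! ### Row `175c1` = `[0, 1, 1, 42, -131]` (`a₂(E) = 2`; `L_W`: `x³ + 2x − 2`, `d = −140`, `h = 1`) -/

/-- `[0,1,1,42,-131] ⊗ ℚ` (`175c1`) is an elliptic curve (`256·Δ = disc(X³ + 4X² + 672X − 8368) ≠ 0`). [folklore] -/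
theorem isElliptic_175c1 : ((⟨0, 1, 1, 42, -131⟩ : WeierstrassCurve ℤ).baseChange ℚ).IsElliptic :=
  isElliptic_goodSSModel _ _ _ (by simp only [Cubic.discr]; norm_num)

/-- **(A)₂ for `175c1` modulo Lim 2017 Thm. 3.5 (`hLim2`) + ONE displayed bit `2 ∤ #Cl(𝓞 ℚ(β))`** (census value: `h(L_W) = 1`, `d(L_W) = −140` — PARI, not kernel). Row data (Cremona `allcurves`/`allbsd`): minimal model `[0,1,1,42,-131]`, `N = 175`, `a₂(E) = 2` (good supersingular at `2`), `r = 0`, `#tors = 1`, non-CM; `2`-division cubic of `β = 4x(P)`: `X³ + 4X² + 672X − 8368`; Eisenstein cubic of `π = 2x(P)`: `Y³ + 2Y² + 168Y − 1046`; `L_W = ℚ(β) ≅ ℚ[x]/(x³ + 2x − 2)`, complex cubic (Δ_E < 0), `d(L_W) = −140`, `h(L_W) = 1` (kit j343820: polredabs/bnfinit, `bnfcertify = 1`). [cite: Lim2017FineSelmer, §3 Thm. 3.5 and Lemma 3.2] [cite: CoatesSujatha2005, §3 statement (A)] -/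
theorem conjA_two_175c1_of_oddClassNumber
    (hLim2 : Lim2017.thm35_at_two_fineSelmerDual_moduleFinite_of_classicalMuVanishes_of_le_divisionField_four)
    {β : AlgebraicClosure ℚ} (hβ : aeval β (Cubic.toPoly ⟨1, ((4 : ℤ) : ℚ), ((672 : ℤ) : ℚ), ((-8368 : ℤ) : ℚ)⟩) = 0)
    (hh : ¬ 2 ∣ Nat.card (ClassGroup (𝓞 (IntermediateField.adjoin ℚ {β}))))
    (κ : ZpExtension ℚ 2) (hκ : κ.IsCyclotomic) :
    haveI := isElliptic_175c1
    ∃ (γ : absoluteGaloisGroup ℚ) (D : ((⟨0, 1, 1, 42, -131⟩ : WeierstrassCurve ℤ).baseChange ℚ).FineSelmerDualData κ γ),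
      Module.Finite ℤ_[2] (RestrictScalars ℤ_[2] (IwasawaAlgebra 2) D.X) := by
  haveI := isElliptic_175c1
  exact conjA_two_goodSSModel_of_oddClassNumber hLim2 (1) (42) (-131) (by norm_num) (by norm_num) (by norm_num) hβ hh κ hκ

/-- **`FineMuZeroAt (175c1 ⊗ ℚ) 2` modulo `hLim2` + the displayed bit `2 ∤ #Cl(𝓞 ℚ(β))`** (`β` a root of `X³ + 4X² + 672X − 8368`; census: `h(L_W) = 1`). [cite: Lim2017FineSelmer, §3 Thm. 3.5 and Lemma 3.2] [cite: CoatesSujatha2005, §3 statement (A)] -/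
theorem fineMuZeroAt_two_175c1_of_oddClassNumber
    (hLim2 : Lim2017.thm35_at_two_fineSelmerDual_moduleFinite_of_classicalMuVanishes_of_le_divisionField_four)
    {β : AlgebraicClosure ℚ} (hβ : aeval β (Cubic.toPoly ⟨1, ((4 : ℤ) : ℚ), ((672 : ℤ) : ℚ), ((-8368 : ℤ) : ℚ)⟩) = 0)
    (hh : ¬ 2 ∣ Nat.card (ClassGroup (𝓞 (IntermediateField.adjoin ℚ {β})))) :
    haveI := isElliptic_175c1
    Literature.NumberTheory.EllipticCurves.Rank1Residual.FineMuZeroAt ((⟨0, 1, 1, 42, -131⟩ : WeierstrassCurve ℤ).baseChange ℚ) 2 :=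
  haveI := isElliptic_175c1
  fineMuZeroAt_two_goodSSModel_of_oddClassNumber hLim2 (1) (42) (-131) (by norm_num) (by norm_num) (by norm_num) hβ hh

/-! ### Row `179a1` = `[0, 0, 1, -1, -1]` (`a₂(E) = 2`; `L_W`: `x³ − 4x − 6`, `d = −716`, `h = 1`) -/

-- `IsElliptic` for `179a1 ⊗ ℚ` is the tree's `SSUnitAnchor.isElliptic_ua179a1` (reused, not restated).

/-- **(A)₂ for `179a1` modulo Lim 2017 Thm. 3.5 (`hLim2`) + ONE displayed bit `2 ∤ #Cl(𝓞 ℚ(β))`** (census value: `h(L_W) = 1`, `d(L_W) = −716` — PARI, not kernel). Row data (Cremona `allcurves`/`allbsd`): minimal model `[0,0,1,-1,-1]`, `N = 179`, `a₂(E) = 2` (good supersingular at `2`), `r = 0`, `#tors = 1`, non-CM; `2`-division cubic of `β = 4x(P)`: `X³ − 16X − 48`; Eisenstein cubic of `π = 2x(P)`: `Y³ − 4Y − 6`; `L_W = ℚ(β) ≅ ℚ[x]/(x³ − 4x − 6)`, complex cubic (Δ_E < 0), `d(L_W) = −716`, `h(L_W) = 1` (kit j343820: polredabs/bnfinit, `bnfcertify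 = 1`). [cite: Lim2017FineSelmer, §3 Thm. 3.5 and Lemma 3.2] [cite: CoatesSujatha2005, §3 statement (A)] -/
theorem conjA_two_179a1_of_oddClassNumber
    (hLim2 : Lim2017.thm35_at_two_fineSelmerDual_moduleFinite_of_classicalMuVanishes_of_le_divisionField_four)
    {β : AlgebraicClosure ℚ} (hβ : aeval β (Cubic.toPoly ⟨1, ((0 : ℤ) : ℚ), ((-16 : ℤ) : ℚ), ((-48 : ℤ) : ℚ)⟩) = 0)
    (hh : ¬ 2 ∣ Nat.card (ClassGroup (𝓞 (IntermediateField.adjoin ℚ {β}))))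
    (κ : ZpExtension ℚ 2) (hκ : κ.IsCyclotomic) :
    haveI := SSUnitAnchor.isElliptic_ua179a1
    ∃ (γ : absoluteGaloisGroup ℚ) (D : ((⟨0, 0, 1, -1, -1⟩ : WeierstrassCurve ℤ).baseChange ℚ).FineSelmerDualData κ γ),
      Module.Finite ℤ_[2] (RestrictScalars ℤ_[2] (IwasawaAlgebra 2) D.X) := by
  haveI := SSUnitAnchor.isElliptic_ua179a1
  exact conjA_two_goodSSModel_of_oddClassNumber hLim2 (0) (-1) (-1) (by norm_num) (by norm_num) (by norm_num) hβ hh κ hκ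

/-- **`FineMuZeroAt (179a1 ⊗ ℚ) 2` modulo `hLim2` + the displayed bit `2 ∤ #Cl(𝓞 ℚ(β))`** (`β` a root of `X³ − 16X − 48`; census: `h(L_W) = 1`). [cite: Lim2017FineSelmer, §3 Thm. 3.5 and Lemma 3.2] [cite: CoatesSujatha2005, §3 statement (A)] -/
theorem fineMuZeroAt_two_179a1_of_oddClassNumber
    (hLim2 : Lim2017.thm35_at_two_fineSelmerDual_moduleFinite_of_classicalMuVanishes_of_le_divisionField_four)
    {β : AlgebraicClosure ℚ} (hβ : aeval β (Cubic.toPoly ⟨1, ((0 : ℤ) : ℚ), ((-16 : ℤ) : ℚ), ((-48 : ℤ) : ℚ)⟩) = 0)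
    (hh : ¬ 2 ∣ Nat.card (ClassGroup (𝓞 (IntermediateField.adjoin ℚ {β})))) :
    haveI := SSUnitAnchor.isElliptic_ua179a1
    Literature.NumberTheory.EllipticCurves.Rank1Residual.FineMuZeroAt ((⟨0, 0, 1, -1, -1⟩ : WeierstrassCurve ℤ).baseChange ℚ) 2 :=
  haveI := SSUnitAnchor.isElliptic_ua179a1
  fineMuZeroAt_two_goodSSModel_of_oddClassNumber hLim2 (0) (-1) (-1) (by norm_num) (by norm_num) (by norm_num) hβ hh

/-! ### Row `187a1` = `[0, 1, 1, 11, 30]` (`a₂(E) = 0`; `L_W`: `x³ − x² + x + 1`, `d = −44`, `h = 1`) -/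

/-- `[0,1,1,11,30] ⊗ ℚ` (`187a1`) is an elliptic curve (`256·Δ = disc(X³ + 4X² + 176X + 1936) ≠ 0`). [folklore] -/
theorem isElliptic_187a1 : ((⟨0, 1, 1, 11, 30⟩ : WeierstrassCurve ℤ).baseChange ℚ).IsElliptic :=
  isElliptic_goodSSModel _ _ _ (by simp only [Cubic.discr]; norm_num)

/-- **(A)₂ for `187a1` modulo Lim 2017 Thm. 3.5 (`hLim2`) ALONE — NO displayed datum.** Generator swap: `θ = (5/17) + (31/374)·β + (-1/748)·β²` is a root of `g = X³ − X² + X + 1` (`d = −44`) and `β = (-4) + (10)·θ + (2)·θ²`, so `ℚ(P) = ℚ(β) = ℚ(θ)`; `2 ∤ #Cl(𝓞 ℚ(θ))` BY THE KERNEL (|disc g| = 44 ≤ 45, `…CubicDiscriminant.not_two_dvd_card_classGroup_adjoin_of_abs_discr_le`). Row data (Cremona `allcurves`/`allbsd`): minimal model `[0,1,1,11,30]`, `N = 187`, `a₂(E) = 0` (good supersingular at `2`), `r = 0`, `#tors = 3`, non-CM; `2`-division cubic of `β = 4x(P)`: `X³ + 4X² + 176X + 1936`; Eisenstein cubic of `π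 = 2x(P)`: `Y³ + 2Y² + 44Y + 242`; `L_W = ℚ(β) ≅ ℚ[x]/(x³ − x² + x + 1)`, complex cubic (Δ_E < 0), `d(L_W) = −44`, `h(L_W) = 1` (kit j343820: polredabs/bnfinit, `bnfcertify = 1`). [cite: Lim2017FineSelmer, §3 Thm. 3.5 and Lemma 3.2] [cite: CoatesSujatha2005, §3 statement (A)] -/
theorem conjA_two_187a1
    (hLim2 : Lim2017.thm35_at_two_fineSelmerDual_moduleFinite_of_classicalMuVanishes_of_le_divisionField_four)
    (κ : ZpExtension ℚ 2) (hκ : κ.IsCyclotomic) :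
    haveI := isElliptic_187a1
    ∃ (γ : absoluteGaloisGroup ℚ) (D : ((⟨0, 1, 1, 11, 30⟩ : WeierstrassCurve ℤ).baseChange ℚ).FineSelmerDualData κ γ),
      Module.Finite ℤ_[2] (RestrictScalars ℤ_[2] (IwasawaAlgebra 2) D.X) := by
  haveI := isElliptic_187a1
  refine conjA_two_goodSSModel_of_generator hLim2 (1) (11) (30) (-1) (1) (1) (5/17) (31/374) (-1/748) (-4) (10) (2)
    (fun β θ hβ hθ ↦ ?_) (fun θ hθ ↦ not_two_dvd_card_classGroup_twoDivField_d44n hθ) κ hκ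
  subst hθ; push_cast at hβ ⊢
  exact ⟨by linear_combination (((3029 : AlgebraicClosure ℚ) / 4755784) + ((-3051 : AlgebraicClosure ℚ) / 104627248) * β + ((95 : AlgebraicClosure ℚ) / 209254496) * β ^ 2 + ((-1 : AlgebraicClosure ℚ) / 418508992) * β ^ 3) * hβ,
    by linear_combination (-1 : AlgebraicClosure ℚ) * (((-16 : AlgebraicClosure ℚ) / 34969) + ((1 : AlgebraicClosure ℚ) / 279752) * β) * hβ⟩

/-- **`FineMuZeroAt (187a1 ⊗ ℚ) 2` modulo `hLim2` ALONE** (kernel bit via the `d = −44` generator swap). [cite: Lim2017FineSelmer, §3 Thm. 3.5 and Lemma 3.2] [cite: CoatesSujatha2005, §3 statement (A)] -/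
theorem fineMuZeroAt_two_187a1
    (hLim2 : Lim2017.thm35_at_two_fineSelmerDual_moduleFinite_of_classicalMuVanishes_of_le_divisionField_four) :
    haveI := isElliptic_187a1
    Literature.NumberTheory.EllipticCurves.Rank1Residual.FineMuZeroAt ((⟨0, 1, 1, 11, 30⟩ : WeierstrassCurve ℤ).baseChange ℚ) 2 :=
  haveI := isElliptic_187a1
  Literature.NumberTheory.EllipticCurves.Rank1Residual.ConjAAt.fineMuZeroAt (conjA_two_187a1 hLim2)

/-! ### Row `187b1` = `[0, 0, 1, 7, 1]` (`a₂(E) = 2`; `L_W`: `x³ − x² + x + 5`, `d = −748`, `h = 1`) -/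

-- `IsElliptic` for `187b1 ⊗ ℚ` is the tree's `SSUnitAnchor.isElliptic_ua187b1` (reused, not restated).

/-- **(A)₂ for `187b1` modulo Lim 2017 Thm. 3.5 (`hLim2`) + ONE displayed bit `2 ∤ #Cl(𝓞 ℚ(β))`** (census value: `h(L_W) = 1`, `d(L_W) = −748` — PARI, not kernel). Row data (Cremona `allcurves`/`allbsd`): minimal model `[0,0,1,7,1]`, `N = 187`, `a₂(E) = 2` (good supersingular at `2`), `r = 0`, `#tors = 1`, non-CM; `2`-division cubic of `β = 4x(P)`: `X³ + 112X + 80`; Eisenstein cubic of `π = 2x(P)`: `Y³ + 28Y + 10`; `L_W = ℚ(β) ≅ ℚ[x]/(x³ − x² + x + 5)`, complex cubic (Δ_E < 0), `d(L_W) = −748`, `h(L_W) = 1` (kit j343820: polredabs/bnfinit, `bnfcertify = 1`). [cite: Lim2017FineSelmer, §3 Thm. 3.5 and Lemma 3.2] [cite: CoatesSujatha2005, §3 statement (A)] -/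
theorem conjA_two_187b1_of_oddClassNumber
    (hLim2 : Lim2017.thm35_at_two_fineSelmerDual_moduleFinite_of_classicalMuVanishes_of_le_divisionField_four)
    {β : AlgebraicClosure ℚ} (hβ : aeval β (Cubic.toPoly ⟨1, ((0 : ℤ) : ℚ), ((112 : ℤ) : ℚ), ((80 : ℤ) : ℚ)⟩) = 0)
    (hh : ¬ 2 ∣ Nat.card (ClassGroup (𝓞 (IntermediateField.adjoin ℚ {β}))))
    (κ : ZpExtension ℚ 2) (hκ : κ.IsCyclotomic) :
    haveI := SSUnitAnchor.isElliptic_ua187b1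
    ∃ (γ : absoluteGaloisGroup ℚ) (D : ((⟨0, 0, 1, 7, 1⟩ : WeierstrassCurve ℤ).baseChange ℚ).FineSelmerDualData κ γ),
      Module.Finite ℤ_[2] (RestrictScalars ℤ_[2] (IwasawaAlgebra 2) D.X) := by
  haveI := SSUnitAnchor.isElliptic_ua187b1
  exact conjA_two_goodSSModel_of_oddClassNumber hLim2 (0) (7) (1) (by norm_num) (by norm_num) (by norm_num) hβ hh κ hκ

/-- **`FineMuZeroAt (187b1 ⊗ ℚ) 2` modulo `hLim2` + the displayed bit `2 ∤ #Cl(𝓞 ℚ(β))`** (`β` a root of `X³ + 112X + 80`; census: `h(L_W) = 1`). [cite: Lim2017FineSelmer, §3 Thm. 3.5 and Lemma 3.2] [cite: CoatesSujatha2005, §3 statement (A)] -/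
theorem fineMuZeroAt_two_187b1_of_oddClassNumber
    (hLim2 : Lim2017.thm35_at_two_fineSelmerDual_moduleFinite_of_classicalMuVanishes_of_le_divisionField_four)
    {β : AlgebraicClosure ℚ} (hβ : aeval β (Cubic.toPoly ⟨1, ((0 : ℤ) : ℚ), ((112 : ℤ) : ℚ), ((80 : ℤ) : ℚ)⟩) = 0)
    (hh : ¬ 2 ∣ Nat.card (ClassGroup (𝓞 (IntermediateField.adjoin ℚ {β})))) :
    haveI := SSUnitAnchor.isElliptic_ua187b1
    Literature.NumberTheory.EllipticCurves.Rank1Residual.FineMuZeroAt ((⟨0, 0, 1, 7, 1⟩ : WeierstrassCurve ℤ).baseChange ℚ) 2 :=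
  haveI := SSUnitAnchor.isElliptic_ua187b1
  fineMuZeroAt_two_goodSSModel_of_oddClassNumber hLim2 (0) (7) (1) (by norm_num) (by norm_num) (by norm_num) hβ hh

/-! ### Row `189c1` = `[0, 0, 1, -6, 3]` (`a₂(E) = 0`; `L_W`: `x³ − 6x − 2`, `d = 756`, `h = 1`) -/

/-- `[0,0,1,-6,3] ⊗ ℚ` (`189c1`) is an elliptic curve (`256·Δ = disc(X³ − 96X + 208) ≠ 0`). [folklore] -/
theorem isElliptic_189c1 : ((⟨0, 0, 1, -6, 3⟩ : WeierstrassCurve ℤ).baseChange ℚ).IsElliptic :=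
  isElliptic_goodSSModel _ _ _ (by simp only [Cubic.discr]; norm_num)

/-- **(A)₂ for `189c1` modulo Lim 2017 Thm. 3.5 (`hLim2`) + ONE displayed bit `2 ∤ #Cl(𝓞 ℚ(β))`** (census value: `h(L_W) = 1`, `d(L_W) = 756` — PARI, not kernel). Row data (Cremona `allcurves`/`allbsd`): minimal model `[0,0,1,-6,3]`, `N = 189`, `a₂(E) = 0` (good supersingular at `2`), `r = 0`, `#tors = 3`, non-CM; `2`-division cubic of `β = 4x(P)`: `X³ − 96X + 208`; Eisenstein cubic of `π = 2x(P)`: `Y³ − 24Y + 26`; `L_W = ℚ(β) ≅ ℚ[x]/(x³ − 6x − 2)`, totally real cubic (Δ_E > 0), `d(L_W) = 756`, `h(L_W) = 1` (kit j343820: polredabs/bnfinit, `bnfcertify = 1`). [cite: Lim2017FineSelmer, §3 Thm. 3.5 and Lemma 3.2] [cite: CoatesSujatha2005, §3 statement (A)] -/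
theorem conjA_two_189c1_of_oddClassNumber
    (hLim2 : Lim2017.thm35_at_two_fineSelmerDual_moduleFinite_of_classicalMuVanishes_of_le_divisionField_four)
    {β : AlgebraicClosure ℚ} (hβ : aeval β (Cubic.toPoly ⟨1, ((0 : ℤ) : ℚ), ((-96 : ℤ) : ℚ), ((208 : ℤ) : ℚ)⟩) = 0)
    (hh : ¬ 2 ∣ Nat.card (ClassGroup (𝓞 (IntermediateField.adjoin ℚ {β}))))
    (κ : ZpExtension ℚ 2) (hκ : κ.IsCyclotomic) :
    haveI := isElliptic_189c1
    ∃ (γ : absoluteGaloisGroup ℚ) (D : ((⟨0, 0, 1, -6, 3⟩ : WeierstrassCurve ℤ).baseChange ℚ).FineSelmerDualData κ γ),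
      Module.Finite ℤ_[2] (RestrictScalars ℤ_[2] (IwasawaAlgebra 2) D.X) := by
  haveI := isElliptic_189c1
  exact conjA_two_goodSSModel_of_oddClassNumber hLim2 (0) (-6) (3) (by norm_num) (by norm_num) (by norm_num) hβ hh κ hκ

/-- **`FineMuZeroAt (189c1 ⊗ ℚ) 2` modulo `hLim2` + the displayed bit `2 ∤ #Cl(𝓞 ℚ(β))`** (`β` a root of `X³ − 96X + 208`; census: `h(L_W) = 1`). [cite: Lim2017FineSelmer, §3 Thm. 3.5 and Lemma 3.2] [cite: CoatesSujatha2005, §3 statement (A)] -/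
theorem fineMuZeroAt_two_189c1_of_oddClassNumber
    (hLim2 : Lim2017.thm35_at_two_fineSelmerDual_moduleFinite_of_classicalMuVanishes_of_le_divisionField_four)
    {β : AlgebraicClosure ℚ} (hβ : aeval β (Cubic.toPoly ⟨1, ((0 : ℤ) : ℚ), ((-96 : ℤ) : ℚ), ((208 : ℤ) : ℚ)⟩) = 0)
    (hh : ¬ 2 ∣ Nat.card (ClassGroup (𝓞 (IntermediateField.adjoin ℚ {β})))) :
    haveI := isElliptic_189c1
    Literature.NumberTheory.EllipticCurves.Rank1Residual.FineMuZeroAt ((⟨0, 0, 1, -6, 3⟩ : WeierstrassCurve ℤ).baseChange ℚ) 2 :=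
  haveI := isElliptic_189c1
  fineMuZeroAt_two_goodSSModel_of_oddClassNumber hLim2 (0) (-6) (3) (by norm_num) (by norm_num) (by norm_num) hβ hh

/-! ### Row `189d1` = `[0, 0, 1, -27, -7]` (`a₂(E) = 2`; `L_W`: `x³ − 6x − 2`, `d = 756`, `h = 1`) -/

-- `IsElliptic` for `189d1 ⊗ ℚ` is the tree's `SSUnitAnchor.isElliptic_ua189d1` (reused, not restated).

/-- **(A)₂ for `189d1` modulo Lim 2017 Thm. 3.5 (`hLim2`) + ONE displayed bit `2 ∤ #Cl(𝓞 ℚ(β))`** (census value: `h(L_W) = 1`, `d(L_W) = 756` — PARI, not kernel). Row data (Cremona `allcurves`/`allbsd`): minimal model `[0,0,1,-27,-7]`, `N = 189`, `a₂(E) = 2` (good supersingular at `2`), `r = 0`, `#tors = 1`, non-CM; `2`-division cubic of `β = 4x(P)`: `X³ − 432X − 432`; Eisenstein cubic of `π = 2x(P)`: `Y³ − 108Y − 54`; `L_W = ℚ(β) ≅ ℚ[x]/(x³ − 6x − 2)`, totally real cubic (Δ_E > 0), `d(L_W) = 756`, `h(L_W) = 1` (kit j343820: polredabs/bnfinit,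 `bnfcertify = 1`). [cite: Lim2017FineSelmer, §3 Thm. 3.5 and Lemma 3.2] [cite: CoatesSujatha2005, §3 statement (A)] -/
theorem conjA_two_189d1_of_oddClassNumber
    (hLim2 : Lim2017.thm35_at_two_fineSelmerDual_moduleFinite_of_classicalMuVanishes_of_le_divisionField_four)
    {β : AlgebraicClosure ℚ} (hβ : aeval β (Cubic.toPoly ⟨1, ((0 : ℤ) : ℚ), ((-432 : ℤ) : ℚ), ((-432 : ℤ) : ℚ)⟩) = 0)
    (hh : ¬ 2 ∣ Nat.card (ClassGroup (𝓞 (IntermediateField.adjoin ℚ {β}))))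
    (κ : ZpExtension ℚ 2) (hκ : κ.IsCyclotomic) :
    haveI := SSUnitAnchor.isElliptic_ua189d1
    ∃ (γ : absoluteGaloisGroup ℚ) (D : ((⟨0, 0, 1, -27, -7⟩ : WeierstrassCurve ℤ).baseChange ℚ).FineSelmerDualData κ γ),
      Module.Finite ℤ_[2] (RestrictScalars ℤ_[2] (IwasawaAlgebra 2) D.X) := by
  haveI := SSUnitAnchor.isElliptic_ua189d1
  exact conjA_two_goodSSModel_of_oddClassNumber hLim2 (0) (-27) (-7) (by norm_num) (by norm_num) (by norm_num) hβ hh κ hκ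

/-- **`FineMuZeroAt (189d1 ⊗ ℚ) 2` modulo `hLim2` + the displayed bit `2 ∤ #Cl(𝓞 ℚ(β))`** (`β` a root of `X³ − 432X − 432`; census: `h(L_W) = 1`). [cite: Lim2017FineSelmer, §3 Thm. 3.5 and Lemma 3.2] [cite: CoatesSujatha2005, §3 statement (A)] -/
theorem fineMuZeroAt_two_189d1_of_oddClassNumber
    (hLim2 : Lim2017.thm35_at_two_fineSelmerDual_moduleFinite_of_classicalMuVanishes_of_le_divisionField_four)
    {β : AlgebraicClosure ℚ} (hβ : aeval β (Cubic.toPoly ⟨1, ((0 : ℤ) : ℚ), ((-432 : ℤ) : ℚ), ((-432 : ℤ) : ℚ)⟩) = 0)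
    (hh : ¬ 2 ∣ Nat.card (ClassGroup (𝓞 (IntermediateField.adjoin ℚ {β})))) :
    haveI := SSUnitAnchor.isElliptic_ua189d1
    Literature.NumberTheory.EllipticCurves.Rank1Residual.FineMuZeroAt ((⟨0, 0, 1, -27, -7⟩ : WeierstrassCurve ℤ).baseChange ℚ) 2 :=
  haveI := SSUnitAnchor.isElliptic_ua189d1
  fineMuZeroAt_two_goodSSModel_of_oddClassNumber hLim2 (0) (-27) (-7) (by norm_num) (by norm_num) (by norm_num) hβ hh

/-! ### Row `195b1` = `[0, 1, 1, 0, -1]` (`a₂(E) = 2`; `L_W`: `x³ − x² − x − 5`, `d = −780`, `h = 1`) -/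

-- `IsElliptic` for `195b1 ⊗ ℚ` is the tree's `SSUnitAnchor.isElliptic_ua195b1` (reused, not restated).

/-- **(A)₂ for `195b1` modulo Lim 2017 Thm. 3.5 (`hLim2`) ALONE — NO displayed datum.** Generator swap: `θ = (1) + (1/2)·β + (0)·β²` is a root of `g = X³ − X² − X − 5` (`d = −780`) and `β = (-2) + (2)·θ + (0)·θ²`, so `ℚ(P) = ℚ(β) = ℚ(θ)`; `2 ∤ #Cl(𝓞 ℚ(θ))` BY THE KERNEL (norm certificate `…ClassNumberOne780.card_classGroup_adjoin_eq_one_disc_neg780`). Row data (Cremona `allcurves`/`allbsd`): minimal model `[0,1,1,0,-1]`, `N = 195`, `a₂(E) = 2` (good supersingular at `2`), `r = 0`, `#tors = 1`, non-CM; `2`-division cubic of `β = 4x(P)`: `X³ + 4X² − 48`; Eisenstein cubic of `π = 2x(P)`: `Y³ + 2Y² − 6`; `L_W = ℚ(β) ≅ ℚ[x]/(x³ − x² − x − 5)`, complex cubic (Δ_E < 0), `d(L_W) = −780`, `h(L_W) = 1` (kit j343820: polredabs/bnfinit, `bnfcertify = 1`). [cite: Lim2017FineSelmer, §3 Thm.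 3.5 and Lemma 3.2] [cite: CoatesSujatha2005, §3 statement (A)] -/
theorem conjA_two_195b1
    (hLim2 : Lim2017.thm35_at_two_fineSelmerDual_moduleFinite_of_classicalMuVanishes_of_le_divisionField_four)
    (κ : ZpExtension ℚ 2) (hκ : κ.IsCyclotomic) :
    haveI := SSUnitAnchor.isElliptic_ua195b1
    ∃ (γ : absoluteGaloisGroup ℚ) (D : ((⟨0, 1, 1, 0, -1⟩ : WeierstrassCurve ℤ).baseChange ℚ).FineSelmerDualData κ γ),
      Module.Finite ℤ_[2] (RestrictScalars ℤ_[2] (IwasawaAlgebra 2) D.X) := by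
  haveI := SSUnitAnchor.isElliptic_ua195b1
  refine conjA_two_goodSSModel_of_generator hLim2 (1) (0) (-1) (-1) (-1) (-5) (1) (1/2) (0) (-2) (2) (0)
    (fun β θ hβ hθ ↦ ?_) (fun θ hθ ↦ not_two_dvd_card_classGroup_twoDivField_d780n hθ) κ hκ
  subst hθ; push_cast at hβ ⊢
  exact ⟨by linear_combination (((1 : AlgebraicClosure ℚ) / 8)) * hβ,
    by linear_combination (-1 : AlgebraicClosure ℚ) * (0 : AlgebraicClosure ℚ) * hβ⟩

/-- **`FineMuZeroAt (195b1 ⊗ ℚ) 2` modulo `hLim2` ALONE** (kernel bit via the `d = −780` generator swap). [cite: Lim2017FineSelmer, §3 Thm. 3.5 and Lemma 3.2] [cite: CoatesSujatha2005, §3 statement (A)] -/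
theorem fineMuZeroAt_two_195b1
    (hLim2 : Lim2017.thm35_at_two_fineSelmerDual_moduleFinite_of_classicalMuVanishes_of_le_divisionField_four) :
    haveI := SSUnitAnchor.isElliptic_ua195b1
    Literature.NumberTheory.EllipticCurves.Rank1Residual.FineMuZeroAt ((⟨0, 1, 1, 0, -1⟩ : WeierstrassCurve ℤ).baseChange ℚ) 2 :=
  haveI := SSUnitAnchor.isElliptic_ua195b1
  Literature.NumberTheory.EllipticCurves.Rank1Residual.ConjAAt.fineMuZeroAt (conjA_two_195b1 hLim2)

/-! ### Row `195c1` = `[0, 1, 1, -66, -349]` (`a₂(E) = 2`; `L_W`: `x³ − x² − x − 5`, `d = −780`, `h = 1`) -/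

/-- `[0,1,1,-66,-349] ⊗ ℚ` (`195c1`) is an elliptic curve (`256·Δ = disc(X³ + 4X² − 1056X − 22320) ≠ 0`). [folklore] -/
theorem isElliptic_195c1 : ((⟨0, 1, 1, -66, -349⟩ : WeierstrassCurve ℤ).baseChange ℚ).IsElliptic :=
  isElliptic_goodSSModel _ _ _ (by simp only [Cubic.discr]; norm_num)

/-- **(A)₂ for `195c1` modulo Lim 2017 Thm. 3.5 (`hLim2`) ALONE — NO displayed datum.** Generator swap: `θ = (-39/25) + (-1/750)·β + (1/375)·β²` is a root of `g = X³ − X² − X − 5` (`d = −780`) and `β = (-10) + (2)·θ + (8)·θ²`, so `ℚ(P) = ℚ(β) = ℚ(θ)`; `2 ∤ #Cl(𝓞 ℚ(θ))` BY THE KERNEL (norm certificate `…ClassNumberOne780.card_classGroup_adjoin_eq_one_disc_neg780`). Row data (Cremona `allcurves`/`allbsd`): minimal model `[0,1,1,-66,-349]`, `N = 195`, `a₂(E) = 2` (good supersingular at `2`), `r = 0`, `#tors = 1`, non-CM; `2`-division cubic of `β = 4x(P)`: `X³ + 4X² − 1056X − 22320`; Eisenstein cubic of `π = 2x(P)`: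 `Y³ + 2Y² − 264Y − 2790`; `L_W = ℚ(β) ≅ ℚ[x]/(x³ − x² − x − 5)`, complex cubic (Δ_E < 0), `d(L_W) = −780`, `h(L_W) = 1` (kit j343820: polredabs/bnfinit, `bnfcertify = 1`). [cite: Lim2017FineSelmer, §3 Thm. 3.5 and Lemma 3.2] [cite: CoatesSujatha2005, §3 statement (A)] -/
theorem conjA_two_195c1
    (hLim2 : Lim2017.thm35_at_two_fineSelmerDual_moduleFinite_of_classicalMuVanishes_of_le_divisionField_four)
    (κ : ZpExtension ℚ 2) (hκ : κ.IsCyclotomic) :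
    haveI := isElliptic_195c1
    ∃ (γ : absoluteGaloisGroup ℚ) (D : ((⟨0, 1, 1, -66, -349⟩ : WeierstrassCurve ℤ).baseChange ℚ).FineSelmerDualData κ γ),
      Module.Finite ℤ_[2] (RestrictScalars ℤ_[2] (IwasawaAlgebra 2) D.X) := by
  haveI := isElliptic_195c1
  refine conjA_two_goodSSModel_of_generator hLim2 (1) (-66) (-349) (-1) (-1) (-5) (-39/25) (-1/750) (1/375) (-10) (2) (8)
    (fun β θ hβ hθ ↦ ?_) (fun θ hθ ↦ not_two_dvd_card_classGroup_twoDivField_d780n hθ) κ hκ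
  subst hθ; push_cast at hβ ⊢
  exact ⟨by linear_combination (((2437 : AlgebraicClosure ℚ) / 5625000) + ((-841 : AlgebraicClosure ℚ) / 42187500) * β + ((-11 : AlgebraicClosure ℚ) / 105468750) * β ^ 2 + ((1 : AlgebraicClosure ℚ) / 52734375) * β ^ 3) * hβ,
    by linear_combination (-1 : AlgebraicClosure ℚ) * (((-8 : AlgebraicClosure ℚ) / 28125) + ((8 : AlgebraicClosure ℚ) / 140625) * β) * hβ⟩

/-- **`FineMuZeroAt (195c1 ⊗ ℚ) 2` modulo `hLim2` ALONE** (kernel bit via the `d = −780` generator swap). [cite: Lim2017FineSelmer, §3 Thm. 3.5 and Lemma 3.2] [cite: CoatesSujatha2005, §3 statement (A)] -/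
theorem fineMuZeroAt_two_195c1
    (hLim2 : Lim2017.thm35_at_two_fineSelmerDual_moduleFinite_of_classicalMuVanishes_of_le_divisionField_four) :
    haveI := isElliptic_195c1
    Literature.NumberTheory.EllipticCurves.Rank1Residual.FineMuZeroAt ((⟨0, 1, 1, -66, -349⟩ : WeierstrassCurve ℤ).baseChange ℚ) 2 :=
  haveI := isElliptic_195c1
  Literature.NumberTheory.EllipticCurves.Rank1Residual.ConjAAt.fineMuZeroAt (conjA_two_195c1 hLim2)

/-! ### Row `195d1` = `[0, -1, 1, -190, 1101]` (`a₂(E) = 2`; `L_W`: `x³ − x² − x − 5`, `d = −780`, `h = 1`) -/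

/-- `[0,-1,1,-190,1101] ⊗ ℚ` (`195d1`) is an elliptic curve (`256·Δ = disc(X³ − 4X² − 3040X + 70480) ≠ 0`). [folklore] -/
theorem isElliptic_195d1 : ((⟨0, -1, 1, -190, 1101⟩ : WeierstrassCurve ℤ).baseChange ℚ).IsElliptic :=
  isElliptic_goodSSModel _ _ _ (by simp only [Cubic.discr]; norm_num)

/-- **(A)₂ for `195d1` modulo Lim 2017 Thm. 3.5 (`hLim2`) ALONE — NO displayed datum.** Generator swap: `θ = (2203/351) + (-3/26)·β + (-1/351)·β²` is a root of `g = X³ − X² − X − 5` (`d = −780`) and `β = (14) + (-14)·θ + (-8)·θ²`, so `ℚ(P) = ℚ(β) = ℚ(θ)`; `2 ∤ #Cl(𝓞 ℚ(θ))` BY THE KERNEL (norm certificate `…ClassNumberOne780.card_classGroup_adjoin_eq_one_disc_neg780`). Row data (Cremona `allcurves`/`allbsd`): minimal model `[0,-1,1,-190,1101]`, `N = 195`, `a₂(E) = 2` (good supersingular at `2`), `r = 0`, `#tors = 1`, non-CM; `2`-division cubic of `β = 4x(P)`: `X³ − 4X² − 3040X + 70480`; Eisenstein cubic of `π = 2x(P)`: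 `Y³ − 2Y² − 760Y + 8810`; `L_W = ℚ(β) ≅ ℚ[x]/(x³ − x² − x − 5)`, complex cubic (Δ_E < 0), `d(L_W) = −780`, `h(L_W) = 1` (kit j343820: polredabs/bnfinit, `bnfcertify = 1`). [cite: Lim2017FineSelmer, §3 Thm. 3.5 and Lemma 3.2] [cite: CoatesSujatha2005, §3 statement (A)] -/
theorem conjA_two_195d1
    (hLim2 : Lim2017.thm35_at_two_fineSelmerDual_moduleFinite_of_classicalMuVanishes_of_le_divisionField_four)
    (κ : ZpExtension ℚ 2) (hκ : κ.IsCyclotomic) :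
    haveI := isElliptic_195d1
    ∃ (γ : absoluteGaloisGroup ℚ) (D : ((⟨0, -1, 1, -190, 1101⟩ : WeierstrassCurve ℤ).baseChange ℚ).FineSelmerDualData κ γ),
      Module.Finite ℤ_[2] (RestrictScalars ℤ_[2] (IwasawaAlgebra 2) D.X) := by
  haveI := isElliptic_195d1
  refine conjA_two_goodSSModel_of_generator hLim2 (-1) (-190) (1101) (-1) (-1) (-5) (2203/351) (-3/26) (-1/351) (14) (-14) (-8)
    (fun β θ hβ hθ ↦ ?_) (fun θ hθ ↦ not_two_dvd_card_classGroup_twoDivField_d780n hθ) κ hκ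
  subst hθ; push_cast at hβ ⊢
  exact ⟨by linear_combination (((964871 : AlgebraicClosure ℚ) / 345948408) + ((-8819 : AlgebraicClosure ℚ) / 172974204) * β + ((-251 : AlgebraicClosure ℚ) / 86487102) * β ^ 2 + ((-1 : AlgebraicClosure ℚ) / 43243551) * β ^ 3) * hβ,
    by linear_combination (-1 : AlgebraicClosure ℚ) * (((-680 : AlgebraicClosure ℚ) / 123201) + ((-8 : AlgebraicClosure ℚ) / 123201) * β) * hβ⟩

/-- **`FineMuZeroAt (195d1 ⊗ ℚ) 2` modulo `hLim2` ALONE** (kernel bit via the `d = −780` generator swap). [cite: Lim2017FineSelmer, §3 Thm. 3.5 and Lemma 3.2] [cite: CoatesSujatha2005, §3 statement (A)] -/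
theorem fineMuZeroAt_two_195d1
    (hLim2 : Lim2017.thm35_at_two_fineSelmerDual_moduleFinite_of_classicalMuVanishes_of_le_divisionField_four) :
    haveI := isElliptic_195d1
    Literature.NumberTheory.EllipticCurves.Rank1Residual.FineMuZeroAt ((⟨0, -1, 1, -190, 1101⟩ : WeierstrassCurve ℤ).baseChange ℚ) 2 :=
  haveI := isElliptic_195d1
  Literature.NumberTheory.EllipticCurves.Rank1Residual.ConjAAt.fineMuZeroAt (conjA_two_195d1 hLim2)

/-! ### Row `203a1` = `[0, -1, 1, 20, -8]` (`a₂(E) = −2`; `L_W`: `x³ − x² − 7x − 7`, `d = −812`, `h = 1`) -/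

/-- `[0,-1,1,20,-8] ⊗ ℚ` (`203a1`) is an elliptic curve (`256·Δ = disc(X³ − 4X² + 320X − 496) ≠ 0`). [folklore] -/
theorem isElliptic_203a1 : ((⟨0, -1, 1, 20, -8⟩ : WeierstrassCurve ℤ).baseChange ℚ).IsElliptic :=
  isElliptic_goodSSModel _ _ _ (by simp only [Cubic.discr]; norm_num)

/-- **(A)₂ for `203a1` modulo Lim 2017 Thm. 3.5 (`hLim2`) + ONE displayed bit `2 ∤ #Cl(𝓞 ℚ(β))`** (census value: `h(L_W) = 1`, `d(L_W) = −812` — PARI, not kernel). Row data (Cremona `allcurves`/`allbsd`): minimal model `[0,-1,1,20,-8]`, `N = 203`, `a₂(E) = −2` (good supersingular at `2`), `r = 0`, `#tors = 5`, non-CM; `2`-division cubic of `β = 4x(P)`: `X³ − 4X² + 320X − 496`; Eisenstein cubic of `π = 2x(P)`: `Y³ − 2Y² + 80Y − 62`; `L_W = ℚ(β) ≅ ℚ[x]/(x³ − x² − 7x − 7)`, complex cubic (Δ_E < 0), `d(L_W) = −812`, `h(L_W) = 1` (kit j343820: polredabs/bnfinit, `bnfcertify = 1`). [cite: Lim2017FineSelmer,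 §3 Thm. 3.5 and Lemma 3.2] [cite: CoatesSujatha2005, §3 statement (A)] -/
theorem conjA_two_203a1_of_oddClassNumber
    (hLim2 : Lim2017.thm35_at_two_fineSelmerDual_moduleFinite_of_classicalMuVanishes_of_le_divisionField_four)
    {β : AlgebraicClosure ℚ} (hβ : aeval β (Cubic.toPoly ⟨1, ((-4 : ℤ) : ℚ), ((320 : ℤ) : ℚ), ((-496 : ℤ) : ℚ)⟩) = 0)
    (hh : ¬ 2 ∣ Nat.card (ClassGroup (𝓞 (IntermediateField.adjoin ℚ {β}))))
    (κ : ZpExtension ℚ 2) (hκ : κ.IsCyclotomic) :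
    haveI := isElliptic_203a1
    ∃ (γ : absoluteGaloisGroup ℚ) (D : ((⟨0, -1, 1, 20, -8⟩ : WeierstrassCurve ℤ).baseChange ℚ).FineSelmerDualData κ γ),
      Module.Finite ℤ_[2] (RestrictScalars ℤ_[2] (IwasawaAlgebra 2) D.X) := by
  haveI := isElliptic_203a1
  exact conjA_two_goodSSModel_of_oddClassNumber hLim2 (-1) (20) (-8) (by norm_num) (by norm_num) (by norm_num) hβ hh κ hκ

/-- **`FineMuZeroAt (203a1 ⊗ ℚ) 2` modulo `hLim2` + the displayed bit `2 ∤ #Cl(𝓞 ℚ(β))`** (`β` a root of `X³ − 4X² + 320X − 496`; census: `h(L_W) = 1`). [cite: Lim2017FineSelmer, §3 Thm. 3.5 and Lemma 3.2] [cite: CoatesSujatha2005, §3 statement (A)] -/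
theorem fineMuZeroAt_two_203a1_of_oddClassNumber
    (hLim2 : Lim2017.thm35_at_two_fineSelmerDual_moduleFinite_of_classicalMuVanishes_of_le_divisionField_four)
    {β : AlgebraicClosure ℚ} (hβ : aeval β (Cubic.toPoly ⟨1, ((-4 : ℤ) : ℚ), ((320 : ℤ) : ℚ), ((-496 : ℤ) : ℚ)⟩) = 0)
    (hh : ¬ 2 ∣ Nat.card (ClassGroup (𝓞 (IntermediateField.adjoin ℚ {β})))) :
    haveI := isElliptic_203a1
    Literature.NumberTheory.EllipticCurves.Rank1Residual.FineMuZeroAt ((⟨0, -1, 1, 20, -8⟩ : WeierstrassCurve ℤ).baseChange ℚ) 2 :=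
  haveI := isElliptic_203a1
  fineMuZeroAt_two_goodSSModel_of_oddClassNumber hLim2 (-1) (20) (-8) (by norm_num) (by norm_num) (by norm_num) hβ hh

end Summit.BirchSwinnertonDyer.BirchSwinnertonDyer.Theorems.AddKatoTwo

end
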